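import Literature.Probability.RandomPlanarGeometry.HexSAWBrickWallStripInsertion
import Literature.Probability.RandomPlanarGeometry.HexSAWBrickWallStripInsertionCore
import HarnessLib

/-!
# `μ(S_T) < μ(S_{T+1})` for the strips of the honeycomb lattice, with an explicit margin

Topic `Literature/Probability/RandomPlanarGeometry` (the leaf of the door «HEX-STRIP-STRICT»: `HexSAWBrickWallStripInsertion.lean`
— the four-column insertion `HexBW.stripInsertion` on the brick-wall strips `S_T = ℤ × {0,…,T}` with its three
properties hcost/hmem/hinj — fed to `HexSAWBrickWallStripInsertionCore.lean` — the summation/extraction step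
`HexBW.stripConnectiveConstant_lt_succ_of_insertion`, `HexBW.log_stripConnectiveConstant_succ_sub_log_ge_of_insertion`).
Sources (STATEMENTS — neither printed proof is the one formalised): N. Madras, G. Slade, *The Self-Avoiding Walk*
(1993), §8.2, Theorem 8.2.1, eq. (8.2.13), book p. 269 ("`μ(R[k,T]) < μ(R[k,T+1])` for every `T`", tubes/slabs of `ℤ^d`;
(8.2.11) "`μ(R) < μ`" via the Pattern Theorem), (8.2.13) being proved there, p. 270, by bridge renewal in the tube,
qualitatively; for the honeycomb strips of `T` rows N. R. Beaton, M. Bousquet-Mélou, J. de Gier, H. Duminil-Copin,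
A. J. Guttmann, *Comm. Math. Phys.* 326 (2014) 727–754, Proposition 7 at `y = 1` [arXiv:1109.0358, PDF p. 11, proof
pp. 11–12] ("For `y > 0`, `μ_T(1,y) < μ_{T+1}(1,y)`. Moreover, as `T → ∞`, `μ_T(1,y) → μ(y)`", by prime unfolded arches
and the rationality of the strip generating functions — qualitatively).  LABEL (lane pcv-sawmu, lit-1 gen 10 cell):
`stripConnectiveConstant_lt_succ` / `strictMono_stripConnectiveConstant` / `stripConnectiveConstant_lt_hex` are a
CONSOLIDATION of those printed statements BY A NEW PROOF (an injective four-column insertion with explicit cost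
`≤ 4T + 8`, kernel-checked; neither printed proof is an insertion); the MARGIN
`log_stripConnectiveConstant_succ_sub_log_ge` and the FLOOR twin `log_hexConnectiveConstant_sub_log_stripConnectiveConstant_ge`
are NEW quantitative statements (a first explicit lower bound on the strip gap for `ℍ`; print has the bare
inequality), modest in strength — exponentially small in `T`.  Door «HEX-STRIP-STRICT» of a-idea-1 gen 16 (ROUTES-G16
§2; faces `StripStrictMargin`/`StripStrict` of `Sketch_G16_HexStripStrict`), same class as the square-lattice file
`SAWStripInsertionMargin.lean`.

## Statements (namespace `Literature.Probability.RandomPlanarGeometry.SAW.HexBW`, all PROVED, standard axioms)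

* `stripInsertion_injOn_insDom` — hinj in the `HexBW.insDom` form;
* **`log_stripConnectiveConstant_succ_sub_log_ge`** — `log(1 + μ(S_{T+1})^{-(4T+8)}) / (2(T+1)) ≤ log μ(S_{T+1}) − log μ(S_T)`;
* **`stripConnectiveConstant_lt_succ`** — `μ(S_T) < μ(S_{T+1})`; `strictMono_stripConnectiveConstant`;
  `stripConnectiveConstant_lt_hex` — `μ(S_T) < μ_ℍ`;
* `log_hexConnectiveConstant_sub_log_stripConnectiveConstant_ge` — the floor twin of the locality rate,
  `log(1 + μ_ℍ^{-(4T+8)}) / (2(T+1)) ≤ log μ_ℍ − log μ(S_T)` (ceiling `≤ C/√T`: `HexSAWBrickWallStripLocality.lean`).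
-/

noncomputable section

open Finset Literature.Probability.LatticeModels Literature.Probability.Percolation

namespace Literature.Probability.RandomPlanarGeometry.SAW.HexBW

/-! ### The door: `μ(S_T) < μ(S_{T+1})` on the honeycomb lattice, with margin -/

section Door

open StripInsertion

/-- **(hinj, `insDom` form)** The insertion is injective on `HexBW.insDom T n`.
[cite: MadrasSlade1993, Theorem 8.2.1 (8.2.13) (p. 269; proof by bridge renewal, p. 270 — ℤ^d tubes; not the proof formalised)] -/
theorem stripInsertion_injOn_insDom (T n : ℕ) :
    Set.InjOn (fun q : (Σ _ : Site 2 × (ℕ → Site 2), Finset ℤ) => stripInsertion T n q.1 q.2) ↑(insDom T n) :=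
  (stripInsertion_injOn T n).mono fun _ hq => mem_insDom.1 (Finset.mem_coe.1 hq)

/-- **Strict strip monotonicity on the honeycomb lattice WITH MARGIN**: for every `T ≥ 0`,
`log(1 + μ(S_{T+1})^{-(4T+8)}) / (2(T+1)) ≤ log μ(S_{T+1}) − log μ(S_T)` (the margin is the lane's; the sources
prove the strict inequality without one). [cite: MadrasSlade1993, Theorem 8.2.1 (8.2.13) (p. 269; proof by bridge renewal, p. 270 — ℤ^d tubes; not the proof formalised)]
[cite: BeatonBousquetMelouDeGierDuminilCopinGuttmann2014, Proposition 7 (y = 1) and its proof (arXiv:1109.0358 PDF pp. 11–12; prime unfolded arches — not the proof formalised)] -/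
theorem log_stripConnectiveConstant_succ_sub_log_ge (T : ℕ) :
    Real.log (1 + stripConnectiveConstant (T + 1) ^ (-(4 * (T : ℝ) + 8))) / (2 * ((T : ℝ) + 1)) ≤
      Real.log (stripConnectiveConstant (T + 1)) - Real.log (stripConnectiveConstant T) :=
  log_stripConnectiveConstant_succ_sub_log_ge_of_insertion (Ψ := stripInsertion T) (cost := stripInsertionCost T)
    (fun n p hp c hc => stripInsertionCost_le n p hp c hc) (fun n p R hp hR => stripInsertion_mem n p R hp hR)
    (stripInsertion_injOn_insDom T)

/-- **`μ(S_T) < μ(S_{T+1})` for the strips of the honeycomb lattice** ("`μ_T(1,y) < μ_{T+1}(1,y)`" at `y = 1`;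
Madras–Slade (8.2.13) "`μ(R[k,T]) < μ(R[k,T+1])` for every `T ≥ 0`" in its brick-wall edition).
[cite: BeatonBousquetMelouDeGierDuminilCopinGuttmann2014, Proposition 7 (y = 1) and its proof (arXiv:1109.0358 PDF pp. 11–12; prime unfolded arches — not the proof formalised)]
[cite: MadrasSlade1993, Theorem 8.2.1 (8.2.13) (p. 269; proof by bridge renewal, p. 270 — ℤ^d tubes; not the proof formalised)] -/
theorem stripConnectiveConstant_lt_succ (T : ℕ) : stripConnectiveConstant T < stripConnectiveConstant (T + 1) :=
  stripConnectiveConstant_lt_succ_of_insertion (Ψ := stripInsertion T) (cost := stripInsertionCost T)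
    (fun n p hp c hc => stripInsertionCost_le n p hp c hc) (fun n p R hp hR => stripInsertion_mem n p R hp hR)
    (stripInsertion_injOn_insDom T)

/-- `T ↦ μ(S_T)` is strictly increasing. [cite: BeatonBousquetMelouDeGierDuminilCopinGuttmann2014, Proposition 7 (y = 1) and its proof (arXiv:1109.0358 PDF pp. 11–12; prime unfolded arches — not the proof formalised)] -/
theorem strictMono_stripConnectiveConstant : StrictMono stripConnectiveConstant :=
  strictMono_nat_of_lt_succ stripConnectiveConstant_lt_succ

/-- `μ(S_T) < μ_ℍ` for every `T` ("`μ_T(1,y) → μ(y)`" from strictly below, at `y = 1`).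
[cite: BeatonBousquetMelouDeGierDuminilCopinGuttmann2014, Proposition 7 (y = 1) and its proof (arXiv:1109.0358 PDF pp. 11–12; prime unfolded arches — not the proof formalised)]
[cite: MadrasSlade1993, Theorem 8.2.1 (8.2.11) (p. 269; there via the Pattern Theorem; not the proof formalised)] -/
theorem stripConnectiveConstant_lt_hex (T : ℕ) : stripConnectiveConstant T < hexConnectiveConstant :=
  lt_of_lt_of_le (stripConnectiveConstant_lt_succ T) (stripConnectiveConstant_le (T + 1))

/-- **The floor twin of the locality rate**: `log(1 + μ_ℍ^{-(4T+8)}) / (2(T+1)) ≤ log μ_ℍ − log μ(S_T)` for every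
`T` (from the margin and `μ(S_{T+1}) ≤ μ_ℍ`; the ceiling `log μ_ℍ − log μ(S_T) ≤ C/√T` is
`HexSAWBrickWallStripLocality.lean`). [cite: MadrasSlade1993, Theorem 8.2.1 (8.2.11) (p. 269; there via the Pattern Theorem; not the proof formalised)]
[cite: BeatonBousquetMelouDeGierDuminilCopinGuttmann2014, Proposition 7 (y = 1) and its proof (arXiv:1109.0358 PDF pp. 11–12; prime unfolded arches — not the proof formalised)] -/
theorem log_hexConnectiveConstant_sub_log_stripConnectiveConstant_ge (T : ℕ) :
    Real.log (1 + hexConnectiveConstant ^ (-(4 * (T : ℝ) + 8))) / (2 * ((T : ℝ) + 1)) ≤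
      Real.log hexConnectiveConstant - Real.log (stripConnectiveConstant T) := by
  have h1 := log_stripConnectiveConstant_succ_sub_log_ge T
  have hle := stripConnectiveConstant_le (T + 1)
  have hpos := stripConnectiveConstant_pos (T + 1)
  have h2 : Real.log (stripConnectiveConstant (T + 1)) ≤ Real.log hexConnectiveConstant :=
    Real.log_le_log hpos hle
  have h3 : hexConnectiveConstant ^ (-(4 * (T : ℝ) + 8)) ≤ stripConnectiveConstant (T + 1) ^ (-(4 * (T : ℝ) + 8)) :=
    Real.rpow_le_rpow_of_nonpos hpos hle (by have : (0 : ℝ) ≤ T := Nat.cast_nonneg T; linarith)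
  have h4 : Real.log (1 + hexConnectiveConstant ^ (-(4 * (T : ℝ) + 8))) ≤
      Real.log (1 + stripConnectiveConstant (T + 1) ^ (-(4 * (T : ℝ) + 8))) :=
    Real.log_le_log (by have := Real.rpow_pos_of_pos (hpos.trans_le hle) (-(4 * (T : ℝ) + 8)); linarith)
      (by linarith)
  have h5 : Real.log (1 + hexConnectiveConstant ^ (-(4 * (T : ℝ) + 8))) / (2 * ((T : ℝ) + 1)) ≤
      Real.log (1 + stripConnectiveConstant (T + 1) ^ (-(4 * (T : ℝ) + 8))) / (2 * ((T : ℝ) + 1)) :=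
    div_le_div_of_nonneg_right h4 (by positivity)
  linarith

end Door

end Literature.Probability.RandomPlanarGeometry.SAW.HexBW
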